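import Literature.NumberTheory.Automorphic.HyperspecialUnitarySatakeModP
import HarnessLib

/-!
# The twisted orbit sums `S_λ = ∑_{μ ∈ Wλ} q_F^{⟨ν,μ⟩-⟨ν,λ⟩} x^μ`, `λ` antidominant, form an `R`-basis of the image
# `𝒮_1(ℋ(U(σ,J₀), K₀; R)) = 𝒯_R` of the counting Satake transform, and `ℋ(U_N, K₀; R)` is free on `𝒮_1⁻¹(S_λ)`, over
# EVERY commutative ring `R` (Henniart–Vignéras 2015 §7.13 Thm., Cor., §7.15 Thm.; Zhu 2020 §1.3 Lemma 8)

Topic `NumberTheory/Automorphic`; namespace `Literature.NumberTheory.Automorphic.HermitianLattice[.UnramifiedLocalConjDatum]`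
(lane `lit-hodgefound`, Track 2 foundations; seat `lit-hodgefound-p11`, generation 49, row g49-#8).  Two DEFINITIONS with
bodies (`weylOrbitRev λ`, the `W = C_{S_N}(rev)`-orbit of `λ` as a `Finset`; `twistedOrbitSum R N b λ`) + theorems; no named fact,
no instance, no notation.  The `U_N`-analogue of §4–§6 of the tree's `GL_n` file `IntegralSatakeIsomorphismGL` (g43-#1, Zhu's
Lemma 8), completing g49-#6 (`HyperspecialUnitarySatakeCountingImage`: `𝒮_1(ℋ_R) = 𝒯_R(q_F)`).

## The print

[HenniartVigneras2013] §7.12 Lemma 2 and §7.13 (twisted action `w ∘ e_λ = δ(λ/w(λ))^{…} e_{w(λ)}`, «each factor in the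
expression for `δ(λ/w(λ))` […] is a positive integer, so that by the definition of the twisted action, `S_λ` is an element of
`ℤ[Λ]`»): «For each `λ` in `Λ⁻`, let `W_λ` be its stabilizer in `W_0` and put `S_λ = ∑_{w ∈ W_0/W_λ} w ∘ e_λ`.  […] it is invariant
under the twisted action of `W_0`.  THEOREM. — `S_ℤ` is injective and the family `S_λ`, `λ` in `Λ⁻`, is a basis of its image»;
PROPOSITION («`T_λ = e_λ` if `λ ∉ Λ⁻` and `T_λ = S_λ` for `λ` in `Λ⁻`, is a basis of `ℤ[Λ]`»; proof: «Let `λ` in `Λ⁻`.  If for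
some `w` in `W_0`, `w(λ)` is in `Λ⁻`, then `w(λ) = λ`»); COROLLARY: «The family `(S_λ)_{λ ∈ Λ⁻}` is a basis for the submodule of
`ℤ[Λ]` made out of elements invariant [under] the twisted action of `W_0`.  Indeed if `φ = ∑ a_λ e_λ` is invariant under the
twisted action of `W_0` then `φ - ∑_{λ ∈ Λ⁻} a_λ S_λ` is also invariant, but its support contains no element of `Λ⁻`, so it has
to be `0`»; §7.15 THEOREM: «The map `S_C : H(G, K, C) → C[Λ]` is injective and the family `1_C ⊗ S_λ`, `λ` in `Λ⁻`, is a basis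
of its image (as a `C`-module)»; Remark 1: «Assume `p · 1_C = 0`. […] `1_C ⊗ S_λ = 1_C ⊗ e_λ`».  [ZhuIntegralSatake2020] §1.3
Lemma 8: «a `ℤ`-basis given by elements of the form `∑_{λ̂' ∈ W_0 λ̂} q^{⟨λ, λ̂' - λ̂⟩} e^{λ̂'}`, `λ̂ ∈ X^•(T̂)^{σ,-}`».

HERE `G = U_N = U(σ, J₀^{(N)})`, `Λ = {antisymmetric μ ∈ ℤ^N}`, `Λ⁻ = Λ^{--}` = the monotone antisymmetric `λ` (the tree's
antidominant cone), `W_0 = C_{S_N}(rev)` acting by `μ ↦ μ ∘ π`, the twist `q_F^{⟨ν,μ⟩-⟨ν,λ⟩}` (`⟨ν, ·⟩ = satakeTwistExp`, minimal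
on `W_0 λ` at `λ` by Zhu's rearrangement lemma, g43-#1), and `S_λ = twistedOrbitSum R N q_F λ`; everything is proved for the
submodule `𝒯_R(b) = twistedSatakeTarget R N b` of g49-#6 with an arbitrary base `b ∈ ℕ` and then transported to
`ℋ(U_N, K₀; R)` through the counting Satake isomorphism `countingSatakeLinearEquiv` (g49-#6).

## What is formalised

* §1 `weylOrbitRev` + `mem_weylOrbitRev_iff`, `self_mem_weylOrbitRev`, `comp_mem_weylOrbitRev_iff`, `rev_of_mem_weylOrbitRev`,
  `satakeTwistExp_le_of_mem_weylOrbitRev`, `eq_of_monotone_of_mem_weylOrbitRev` (HV Prop.: «if `w(λ)` is in `Λ⁻`, then `w(λ) = λ`»),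
  `exists_monotone_mem_weylOrbitRev`.
* §2 `twistedOrbitSum` + `coeff_twistedOrbitSum`, `coeff_twistedOrbitSum_self` (`= 1`), `coeff_twistedOrbitSum_eq_zero_of_monotone`,
  **`twistedOrbitSum_mem_twistedSatakeTarget`** (`S_λ ∈ 𝒯_R(b)`), `twistedOrbitSum_of_cast_eq_zero` (`b = 0 ⇒ S_λ = x^λ`, Remark 1).
* §3 `exists_monotone_coeff_ne_zero_of_mem_twisted` (an element of `𝒯_R` with no antidominant exponent is `0`),
  **`eq_sum_coeff_smul_twistedOrbitSum_of_mem`** (COR.: `f = ∑_{λ ∈ Λ⁻} f_λ S_λ` for `f ∈ 𝒯_R`),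
  **`linearIndependent_twistedOrbitSum`**, **`exists_basis_twistedSatakeTarget`** (COR.: `(S_λ)_{λ ∈ Λ⁻}` is an `R`-basis of `𝒯_R(b)`,
  every `R`, every `b`).
* §4 (with `hd : UnramifiedLocalConjDatum σ ϖ`, `σ ≠ id`) `twistedOrbitSum_mem_range_satakeTransform_one` (`S_λ ∈ 𝒮_1(ℋ_R)`),
  **`exists_basis_range_satakeTransform_one_unitary`** (§7.13 THM./§7.15 THM.: `(S_λ)` is an `R`-basis of `𝒮_1(ℋ_R)`),
  **`exists_basis_heckeAlgebra_satakeTransform_one_eq_twistedOrbitSum`** (`ℋ(U_N, K₀; R)` is a free `R`-module with a basis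
  `(B_λ)_{λ ∈ Λ⁻}`, `𝒮_1(B_λ) = S_λ`).

## References
* [HenniartVigneras2013] G. Henniart, M.-F. Vignéras, *A Satake isomorphism for representations modulo p of reductive groups over
  local fields*, J. reine angew. Math. 701 (2015) 33–75, §7.12 Lemma 2, §7.13 Thm./Prop./Cor., §7.15 Thm. and Remark 1.
* [ZhuIntegralSatake2020] X. Zhu, *A note on integral Satake isomorphisms*, arXiv:2005.13056, §1.3 Lemma 8, §1.4 Prop. 9.
* [Herzig2010] F. Herzig, *A Satake isomorphism in characteristic p*, Compositio Math. 147 (2011), §1.2.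
* [TreumannVenkatesh2016] D. Treumann, A. Venkatesh, *Functoriality, Smith theory, and the Brauer homomorphism*, Ann. of Math.
  183 (2016), §7.2.
-/

noncomputable section

open scoped Valued WithZero Matrix MatrixGroups
open MonoidAlgebra Representation

namespace Literature.NumberTheory.Automorphic.HermitianLattice

open Literature.NumberTheory.Automorphic Literature.NumberTheory.Automorphic.CartanUnique
  Literature.NumberTheory.Automorphic.SymplecticCartan

variable {R : Type*} [CommRing R] {N : ℕ}

/-! ## §1 The `W`-orbit of a cocharacter -/

section Orbit

/-- **The `W = C_{S_N}(rev)`-orbit `Wλ = {λ ∘ π : π rev = rev π}` of a cocharacter `λ ∈ ℤ^N`**, as a finite set.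
[cite: HenniartVigneras2013, §7.13] [cite: ZhuIntegralSatake2020, §1.3 Lemma 8] -/
def weylOrbitRev (la : Fin N → ℤ) : Finset (Fin N → ℤ) :=
  (Finset.univ.filter fun π : Equiv.Perm (Fin N) => ∀ i, π (Fin.rev i) = Fin.rev (π i)).image
    fun π : Equiv.Perm (Fin N) => la ∘ ⇑π

omit [CommRing R] in
/-- Membership in the orbit. [cite: HenniartVigneras2013, §7.13] -/
theorem mem_weylOrbitRev_iff {la μ : Fin N → ℤ} :
    μ ∈ weylOrbitRev la ↔ ∃ π : Equiv.Perm (Fin N), (∀ i, π (Fin.rev i) = Fin.rev (π i)) ∧ la ∘ ⇑π = μ := by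
  simp only [weylOrbitRev, Finset.mem_image, Finset.mem_filter, Finset.mem_univ, true_and]

omit [CommRing R] in
/-- `λ ∈ Wλ`. [cite: HenniartVigneras2013, §7.13] -/
theorem self_mem_weylOrbitRev (la : Fin N → ℤ) : la ∈ weylOrbitRev la :=
  mem_weylOrbitRev_iff.2 ⟨1, fun _ => rfl, by rw [Equiv.Perm.coe_one, Function.comp_id]⟩

omit [CommRing R] in
/-- Undoing a coordinate permutation: `(μ ∘ π) ∘ π⁻¹ = μ` (private plumbing). [folklore] -/
private theorem comp_perm_comp_inv' (μ : Fin N → ℤ) (π : Equiv.Perm (Fin N)) : (μ ∘ ⇑π) ∘ ⇑π⁻¹ = μ := by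
  rw [Function.comp_assoc, ← Equiv.Perm.coe_mul, mul_inv_cancel, Equiv.Perm.coe_one, Function.comp_id]

omit [CommRing R] in
/-- The orbit is `W`-stable: `μ ∘ π ∈ Wλ ⟺ μ ∈ Wλ` for `π ∈ W`. [cite: HenniartVigneras2013, §7.13] -/
theorem comp_mem_weylOrbitRev_iff {la μ : Fin N → ℤ} {π : Equiv.Perm (Fin N)} (hπ : ∀ i, π (Fin.rev i) = Fin.rev (π i)) :
    μ ∘ ⇑π ∈ weylOrbitRev la ↔ μ ∈ weylOrbitRev la := by
  constructor
  · intro h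
    obtain ⟨π₁, hπ₁, h1⟩ := mem_weylOrbitRev_iff.1 h
    refine mem_weylOrbitRev_iff.2 ⟨π₁ * π⁻¹, perm_mul_rev hπ₁ (perm_inv_rev hπ), ?_⟩
    rw [Equiv.Perm.coe_mul, ← Function.comp_assoc, h1, comp_perm_comp_inv']
  · intro h
    obtain ⟨π₁, hπ₁, rfl⟩ := mem_weylOrbitRev_iff.1 h
    exact mem_weylOrbitRev_iff.2 ⟨π₁ * π, perm_mul_rev hπ₁ hπ, by rw [Equiv.Perm.coe_mul, Function.comp_assoc]⟩

omit [CommRing R] in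
/-- The orbit of an antisymmetric cocharacter consists of antisymmetric cocharacters. [cite: HenniartVigneras2013, §7.13] -/
theorem rev_of_mem_weylOrbitRev {la μ : Fin N → ℤ} (hla : ∀ i, la (Fin.rev i) = -la i) (h : μ ∈ weylOrbitRev la) (i : Fin N) :
    μ (Fin.rev i) = -μ i := by
  obtain ⟨π, hπ, rfl⟩ := mem_weylOrbitRev_iff.1 h
  rw [Function.comp_apply, Function.comp_apply, hπ, hla]

omit [CommRing R] in
/-- **`⟨ν, ·⟩` is minimal on `Wλ` at the antidominant `λ`**: `⟨ν, λ⟩ ≤ ⟨ν, μ⟩` for `μ ∈ Wλ`, `λ` monotone (so the twist exponents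
`⟨ν,μ⟩ - ⟨ν,λ⟩` are natural numbers — HV: «each factor […] is a positive integer»). [cite: ZhuIntegralSatake2020, §1.3 Lemma 8]
[cite: HenniartVigneras2013, §7.12 Lemma 2, §7.13] -/
theorem satakeTwistExp_le_of_mem_weylOrbitRev {la μ : Fin N → ℤ} (hla : Monotone la) (h : μ ∈ weylOrbitRev la) :
    satakeTwistExp la ≤ satakeTwistExp μ := by
  obtain ⟨π, -, rfl⟩ := mem_weylOrbitRev_iff.1 h
  exact satakeTwistExp_le_satakeTwistExp_comp_perm hla π

omit [CommRing R] in
/-- **The antidominant element of an orbit is unique**: «if for some `w` in `W_0`, `w(λ)` is in `Λ⁻`, then `w(λ) = λ`».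
[cite: HenniartVigneras2013, §7.13 Prop. (proof)] [cite: ZhuIntegralSatake2020, §1.3 Lemma 8] -/
theorem eq_of_monotone_of_mem_weylOrbitRev {la μ : Fin N → ℤ} (hla : Monotone la) (hμ : Monotone μ) (h : μ ∈ weylOrbitRev la) :
    μ = la := by
  obtain ⟨π, -, rfl⟩ := mem_weylOrbitRev_iff.1 h
  refine comp_perm_eq_self_of_monotone_of_satakeTwistExp_le hla π ?_
  have h1 := satakeTwistExp_le_satakeTwistExp_comp_perm hμ π⁻¹
  rwa [comp_perm_comp_inv'] at h1

omit [CommRing R] in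
/-- Every antisymmetric `μ` lies in the orbit of an antidominant (monotone, antisymmetric) `λ`. [cite: HenniartVigneras2013, §6.3, §7.13] -/
theorem exists_monotone_mem_weylOrbitRev {μ : Fin N → ℤ} (hμ : ∀ i, μ (Fin.rev i) = -μ i) :
    ∃ la : Fin N → ℤ, Monotone la ∧ (∀ i, la (Fin.rev i) = -la i) ∧ μ ∈ weylOrbitRev la := by
  obtain ⟨π₀, hπ₀, hm⟩ := exists_perm_rev_monotone_comp hμ
  exact ⟨μ ∘ π₀, hm, fun i => by rw [Function.comp_apply, Function.comp_apply, hπ₀, hμ],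
    mem_weylOrbitRev_iff.2 ⟨π₀⁻¹, perm_inv_rev hπ₀, comp_perm_comp_inv' μ π₀⟩⟩

end Orbit

/-! ## §2 The twisted orbit sums `S_λ` -/

section OrbitSum

variable (R N) in
/-- **The twisted orbit sum `S_λ = ∑_{μ ∈ Wλ} b^{⟨ν,μ⟩-⟨ν,λ⟩} x^μ ∈ R[ℤ^N]`** (`b = q_F`: Henniart–Vignéras' `S_λ = ∑_{w ∈ W_0/W_λ} w ∘ e_λ`
for the twisted action, Zhu's `∑_{λ̂' ∈ W_0 λ̂} q^{⟨λ, λ̂'-λ̂⟩} e^{λ̂'}`). [cite: HenniartVigneras2013, §7.13]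
[cite: ZhuIntegralSatake2020, §1.3 Lemma 8] -/
def twistedOrbitSum (b : ℕ) (la : Fin N → ℤ) : AddMonoidAlgebra R (Fin N → ℤ) :=
  ∑ μ ∈ weylOrbitRev la, ((b : R) ^ (satakeTwistExp μ - satakeTwistExp la).toNat) • AddMonoidAlgebra.single μ (1 : R)

/-- **Coefficients of `S_λ`**: `b^{⟨ν,μ⟩-⟨ν,λ⟩}` on the orbit, `0` off it. [cite: HenniartVigneras2013, §7.13]
[cite: ZhuIntegralSatake2020, §1.3 Lemma 8] -/
theorem coeff_twistedOrbitSum (b : ℕ) (la μ : Fin N → ℤ) :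
    (twistedOrbitSum R N b la).coeff μ =
      if μ ∈ weylOrbitRev la then (b : R) ^ (satakeTwistExp μ - satakeTwistExp la).toNat else 0 := by
  classical
  rw [twistedOrbitSum, AddMonoidAlgebra.coeff_sum, Finsupp.finsetSum_apply]
  simp only [AddMonoidAlgebra.coeff_smul, Finsupp.smul_apply, AddMonoidAlgebra.coeff_single, Finsupp.single_apply,
    smul_eq_mul, mul_ite, mul_one, mul_zero]
  rw [Finset.sum_ite_eq']

/-- `S_λ` has coefficient `1` at `x^λ`. [cite: HenniartVigneras2013, §7.13] -/
theorem coeff_twistedOrbitSum_self (b : ℕ) (la : Fin N → ℤ) : (twistedOrbitSum R N b la).coeff la = 1 := by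
  rw [coeff_twistedOrbitSum, if_pos (self_mem_weylOrbitRev la), sub_self, Int.toNat_zero, pow_zero]

/-- For `λ` and `μ ≠ λ` both antidominant, `S_λ` has no `x^μ` term («all the terms in `S_λ` except `e_λ` itself are in `ℤ e_μ` for
some `μ` in `Λ - Λ⁻`»). [cite: HenniartVigneras2013, §7.13 Prop. (proof)] -/
theorem coeff_twistedOrbitSum_eq_zero_of_monotone {b : ℕ} {la μ : Fin N → ℤ} (hla : Monotone la) (hμ : Monotone μ)
    (hne : μ ≠ la) : (twistedOrbitSum R N b la).coeff μ = 0 := by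
  rw [coeff_twistedOrbitSum, if_neg]
  exact fun h => hne (eq_of_monotone_of_mem_weylOrbitRev hla hμ h)

/-- **`S_λ ∈ 𝒯_R(b)`**: the twisted orbit sum of an antidominant antisymmetric `λ` satisfies the twisted relations («by
construction, it is invariant under the twisted action of `W_0`»). [cite: HenniartVigneras2013, §7.13]
[cite: ZhuIntegralSatake2020, §1.3 Lemma 8] -/
theorem twistedOrbitSum_mem_twistedSatakeTarget (b : ℕ) {la : Fin N → ℤ} (hla : Monotone la ∧ ∀ i, la (Fin.rev i) = -la i) :
    twistedOrbitSum R N b la ∈ twistedSatakeTarget R N b := by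
  refine ⟨fun μ hμ => ?_, fun π hπ μ hle => ?_⟩
  · rw [coeff_twistedOrbitSum, if_neg]
    exact fun h => hμ (rev_of_mem_weylOrbitRev hla.2 h)
  · rw [coeff_twistedOrbitSum, coeff_twistedOrbitSum]
    by_cases hμ : μ ∈ weylOrbitRev la
    · rw [if_pos ((comp_mem_weylOrbitRev_iff hπ).2 hμ), if_pos hμ, ← pow_add]
      congr 1
      have h1 := satakeTwistExp_le_of_mem_weylOrbitRev hla.1 hμ
      omega
    · rw [if_neg (fun h => hμ ((comp_mem_weylOrbitRev_iff hπ).1 h)), if_neg hμ, mul_zero]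

/-- **`S_λ = x^λ` when `b = 0` in `R`** («Assume `p · 1_C = 0`. […] `1_C ⊗ S_λ = 1_C ⊗ e_λ` for all `λ` in `Λ⁻`»): every other
orbit element carries a positive power of `b`. [cite: HenniartVigneras2013, §7.15 Remark 1] -/
theorem twistedOrbitSum_of_cast_eq_zero {b : ℕ} (hb : (b : R) = 0) {la : Fin N → ℤ} (hla : Monotone la) :
    twistedOrbitSum R N b la = AddMonoidAlgebra.single la (1 : R) := by
  classical
  refine AddMonoidAlgebra.coeff_injective (Finsupp.ext fun μ => ?_)
  rw [coeff_twistedOrbitSum, AddMonoidAlgebra.coeff_single, Finsupp.single_apply]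
  by_cases hμ : μ ∈ weylOrbitRev la
  · rw [if_pos hμ]
    by_cases heq : la = μ
    · rw [if_pos heq, heq, sub_self, Int.toNat_zero, pow_zero]
    · rw [if_neg heq, hb, zero_pow]
      intro h0
      obtain ⟨π, -, rfl⟩ := mem_weylOrbitRev_iff.1 hμ
      exact heq (comp_perm_eq_self_of_monotone_of_satakeTwistExp_le hla π (by have := Int.toNat_eq_zero.1 h0; omega)).symm
  · rw [if_neg hμ, if_neg]
    rintro rfl
    exact hμ (self_mem_weylOrbitRev la)

end OrbitSum

/-! ## §3 `(S_λ)_{λ ∈ Λ⁻}` is an `R`-basis of `𝒯_R(b)` -/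

section BasisTarget

/-- **An element of `𝒯_R` is detected on the antidominant cone**: if `f ∈ 𝒯_R(b)` and `f_μ ≠ 0` then `f_λ ≠ 0` at the antidominant
representative `λ` of `Wμ` (the support of `f` is stable under the `⟨ν,·⟩`-non-increasing `W`-moves, g49-#6) — so «its support
contains no element of `Λ⁻`» forces `f = 0`. [cite: HenniartVigneras2013, §7.13 Cor. (proof)] -/
theorem exists_monotone_coeff_ne_zero_of_mem_twisted {b : ℕ} {f : AddMonoidAlgebra R (Fin N → ℤ)}
    (hf : f ∈ twistedSatakeTarget R N b) {μ : Fin N → ℤ} (hμ : f.coeff μ ≠ 0) :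
    ∃ la : Fin N → ℤ, Monotone la ∧ (∀ i, la (Fin.rev i) = -la i) ∧ μ ∈ weylOrbitRev la ∧ f.coeff la ≠ 0 := by
  have hanti : ∀ i, μ (Fin.rev i) = -μ i := by
    by_contra h
    exact hμ (hf.1 μ h)
  obtain ⟨π₀, hπ₀, hm⟩ := exists_perm_rev_monotone_comp hanti
  refine ⟨μ ∘ π₀, hm, fun i => by rw [Function.comp_apply, Function.comp_apply, hπ₀, hanti],
    mem_weylOrbitRev_iff.2 ⟨π₀⁻¹, perm_inv_rev hπ₀, comp_perm_comp_inv' μ π₀⟩, coeff_ne_zero_comp_of_mem_twisted hf hμ hπ₀ ?_⟩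
  have h1 := satakeTwistExp_le_satakeTwistExp_comp_perm hm π₀⁻¹
  rwa [comp_perm_comp_inv'] at h1

/-- **`f = ∑_{λ ∈ Λ⁻ ∩ supp f} f_λ S_λ` for every `f ∈ 𝒯_R(b)`**: the difference lies in `𝒯_R(b)` and has no antidominant exponent,
hence vanishes. [cite: HenniartVigneras2013, §7.13 Cor.] [cite: ZhuIntegralSatake2020, §1.3 Lemma 8] -/
theorem eq_sum_coeff_smul_twistedOrbitSum_of_mem {b : ℕ} {f : AddMonoidAlgebra R (Fin N → ℤ)} (hf : f ∈ twistedSatakeTarget R N b) :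
    f = ∑ la ∈ f.coeff.support.filter Monotone, f.coeff la • twistedOrbitSum R N b la := by
  classical
  rw [← sub_eq_zero]
  set g := f - ∑ la ∈ f.coeff.support.filter Monotone, f.coeff la • twistedOrbitSum R N b la with hg
  have hgmem : g ∈ twistedSatakeTarget R N b := by
    refine Submodule.sub_mem _ hf (Submodule.sum_mem _ fun la hla => Submodule.smul_mem _ _
      (twistedOrbitSum_mem_twistedSatakeTarget b ⟨(Finset.mem_filter.1 hla).2, ?_⟩))
    by_contra h
    exact Finsupp.mem_support_iff.1 (Finset.mem_filter.1 hla).1 (hf.1 la h)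
  -- the coefficients of `g` on the antidominant cone vanish
  have hgm : ∀ m : Fin N → ℤ, Monotone m → g.coeff m = 0 := by
    intro m hm
    rw [hg, AddMonoidAlgebra.coeff_sub, Finsupp.sub_apply, AddMonoidAlgebra.coeff_sum, Finsupp.finsetSum_apply, sub_eq_zero]
    simp only [AddMonoidAlgebra.coeff_smul, Finsupp.smul_apply, smul_eq_mul]
    rw [Finset.sum_eq_single m (fun la hla hne => ?_) (fun hm' => ?_), coeff_twistedOrbitSum_self, mul_one]
    · rw [coeff_twistedOrbitSum_eq_zero_of_monotone (Finset.mem_filter.1 hla).2 hm (Ne.symm hne), mul_zero]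
    · have h0 : f.coeff m = 0 := by
        by_contra h0
        exact hm' (Finset.mem_filter.2 ⟨Finsupp.mem_support_iff.2 h0, hm⟩)
      rw [h0, zero_mul]
  -- hence `g = 0`
  by_contra hne
  obtain ⟨μ, hμ⟩ : ∃ μ, g.coeff μ ≠ 0 := by
    by_contra hall
    push Not at hall
    exact hne (AddMonoidAlgebra.coeff_eq_zero.1 (Finsupp.ext hall))
  obtain ⟨la, hla, -, -, hgla⟩ := exists_monotone_coeff_ne_zero_of_mem_twisted hgmem hμ
  exact hgla (hgm la hla)

/-- **The twisted orbit sums `S_λ`, `λ ∈ Λ⁻`, are `R`-linearly independent** (their restrictions to the antidominant cone are the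
distinct monomials `x^λ`). [cite: HenniartVigneras2013, §7.13 Prop.] [cite: ZhuIntegralSatake2020, §1.3 Lemma 8] -/
theorem linearIndependent_twistedOrbitSum (b : ℕ) :
    LinearIndependent R fun la : {la : Fin N → ℤ // Monotone la ∧ ∀ i, la (Fin.rev i) = -la i} =>
      twistedOrbitSum R N b la.1 := by
  classical
  rw [linearIndependent_iff']
  intro s g hsum la hla
  have h := congrArg (fun x : AddMonoidAlgebra R (Fin N → ℤ) => x.coeff la.1) hsum
  rw [AddMonoidAlgebra.coeff_sum, Finsupp.finsetSum_apply, AddMonoidAlgebra.coeff_zero, Finsupp.zero_apply,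
    Finset.sum_eq_single la (fun la' _ hne => ?_) (fun h' => absurd hla h'), AddMonoidAlgebra.coeff_smul, Finsupp.smul_apply,
    coeff_twistedOrbitSum_self, smul_eq_mul, mul_one] at h
  · exact h
  · rw [AddMonoidAlgebra.coeff_smul, Finsupp.smul_apply,
      coeff_twistedOrbitSum_eq_zero_of_monotone la'.2.1 la.2.1 (fun he => hne (Subtype.ext he.symm)), smul_zero]

/-- **`(S_λ)_{λ ∈ Λ⁻}` IS AN `R`-BASIS OF THE TWISTED INVARIANTS `𝒯_R(b)`**, for every commutative ring `R` and every base `b`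
(«The family `(S_λ)_{λ ∈ Λ⁻}` is a basis for the submodule of `ℤ[Λ]` made out of elements invariant [under] the twisted action of
`W_0`»). [cite: HenniartVigneras2013, §7.13 Cor.] [cite: ZhuIntegralSatake2020, §1.3 Lemma 8] -/
theorem exists_basis_twistedSatakeTarget (b : ℕ) :
    ∃ B : Module.Basis {la : Fin N → ℤ // Monotone la ∧ ∀ i, la (Fin.rev i) = -la i} R (twistedSatakeTarget R N b),
      ∀ la, (B la : AddMonoidAlgebra R (Fin N → ℤ)) = twistedOrbitSum R N b la.1 := by
  classical
  set v : {la : Fin N → ℤ // Monotone la ∧ ∀ i, la (Fin.rev i) = -la i} → twistedSatakeTarget R N b :=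
    fun la => ⟨twistedOrbitSum R N b la.1, twistedOrbitSum_mem_twistedSatakeTarget b la.2⟩ with hv
  have hli : LinearIndependent R v :=
    LinearIndependent.of_comp (twistedSatakeTarget R N b).subtype (linearIndependent_twistedOrbitSum b)
  have hsp : ⊤ ≤ Submodule.span R (Set.range v) := by
    rintro ⟨f, hf⟩ -
    rw [← Submodule.apply_mem_span_image_iff_mem_span (Submodule.injective_subtype _), ← Set.range_comp,
      Submodule.subtype_apply]
    change f ∈ _
    rw [eq_sum_coeff_smul_twistedOrbitSum_of_mem hf]
    refine Submodule.sum_mem _ fun la hla => Submodule.smul_mem _ _ (Submodule.subset_span ⟨⟨la, (Finset.mem_filter.1 hla).2, ?_⟩, rfl⟩)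
    by_contra h
    exact Finsupp.mem_support_iff.1 (Finset.mem_filter.1 hla).1 (hf.1 la h)
  exact ⟨Module.Basis.mk hli hsp, fun la => by rw [Module.Basis.mk_apply]⟩

end BasisTarget

/-! ## §4 Transport to `ℋ(U_N, K₀; R)` -/

variable {K : Type*} [Field K] [Valued K ℤᵐ⁰] {σ : K →+* K} {ϖ : K}

namespace UnramifiedLocalConjDatum

variable [Finite 𝓀[K]]
  [IsHeckeTriple (⊤ : Submonoid (unitaryGroupOfForm σ ((StdForm.antidiagonal N).over K)))
    (unitaryInt σ ((StdForm.antidiagonal N).over K)) (unitaryInt σ ((StdForm.antidiagonal N).over K))]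

/-- **`S_λ ∈ 𝒮_1(ℋ(U_N, K₀; R))`** for every antidominant antisymmetric `λ` and every commutative `R` (g49-#6: `𝒮_1(ℋ_R) = 𝒯_R(q_F)`).
[cite: HenniartVigneras2013, §7.14, §7.15] -/
theorem twistedOrbitSum_mem_range_satakeTransform_one (hd : UnramifiedLocalConjDatum σ ϖ) (hσ : ∃ x : K, σ x ≠ x)
    {la : Fin N → ℤ} (hla : Monotone la ∧ ∀ i, la (Fin.rev i) = -la i) :
    ∃ T : heckeAlgebra R (unitaryGroupOfForm σ ((StdForm.antidiagonal N).over K)) (unitaryInt σ ((StdForm.antidiagonal N).over K)),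
      (hd.isIwasawaExponent (N := N)).satakeTransform 1 T = twistedOrbitSum R N (Nat.sqrt (Nat.card 𝓀[K])) la :=
  hd.exists_satakeTransform_one_eq_of_mem_twisted hσ _ (twistedOrbitSum_mem_twistedSatakeTarget _ hla)

/-- **HENNIART–VIGNÉRAS §7.13/§7.15 FOR `U(σ, J₀)`: the twisted orbit sums `S_λ = ∑_{μ ∈ Wλ} q_F^{⟨ν,μ⟩-⟨ν,λ⟩} x^μ`, `λ ∈ Λ⁻`,
form an `R`-BASIS OF THE IMAGE `𝒮_1(ℋ(U_N, K₀; R))` of the counting Satake transform, for every commutative ring `R`.**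
[cite: HenniartVigneras2013, §7.13 Thm., §7.15 Thm.] [cite: ZhuIntegralSatake2020, §1.3 Lemma 8, §1.4 Prop. 9] -/
theorem exists_basis_range_satakeTransform_one_unitary (hd : UnramifiedLocalConjDatum σ ϖ) (hσ : ∃ x : K, σ x ≠ x) :
    ∃ B : Module.Basis {la : Fin N → ℤ // Monotone la ∧ ∀ i, la (Fin.rev i) = -la i} R
        (LinearMap.range ((hd.isIwasawaExponent (N := N)).satakeTransform (1 : Multiplicative (Fin N → ℤ) →* R)).toLinearMap),
      ∀ la, (B la : AddMonoidAlgebra R (Fin N → ℤ)) = twistedOrbitSum R N (Nat.sqrt (Nat.card 𝓀[K])) la.1 := by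
  rw [hd.range_satakeTransform_one_eq_twistedSatakeTarget hσ]
  exact exists_basis_twistedSatakeTarget _

/-- **`ℋ(U_N, K₀; R)` IS A FREE `R`-MODULE WITH BASIS `(B_λ)_{λ ∈ Λ⁻}`, `𝒮_1(B_λ) = S_λ`**, for every commutative ring `R`
(transport of the basis of `𝒯_R(q_F)` through the counting Satake isomorphism of g49-#6). [cite: HenniartVigneras2013, §7.15 Thm.]
[cite: ZhuIntegralSatake2020, §1.4 Prop. 9] -/
theorem exists_basis_heckeAlgebra_satakeTransform_one_eq_twistedOrbitSum (hd : UnramifiedLocalConjDatum σ ϖ)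
    (hσ : ∃ x : K, σ x ≠ x) :
    ∃ B : Module.Basis {la : Fin N → ℤ // Monotone la ∧ ∀ i, la (Fin.rev i) = -la i} R
        (heckeAlgebra R (unitaryGroupOfForm σ ((StdForm.antidiagonal N).over K)) (unitaryInt σ ((StdForm.antidiagonal N).over K))),
      ∀ la, (hd.isIwasawaExponent (N := N)).satakeTransform (1 : Multiplicative (Fin N → ℤ) →* R) (B la) =
        twistedOrbitSum R N (Nat.sqrt (Nat.card 𝓀[K])) la.1 := by
  obtain ⟨B₀, hB₀⟩ := exists_basis_twistedSatakeTarget (R := R) (N := N) (Nat.sqrt (Nat.card 𝓀[K]))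
  refine ⟨B₀.map (hd.countingSatakeLinearEquiv hσ).symm, fun la => ?_⟩
  rw [Module.Basis.map_apply]
  have h1 := hd.countingSatakeLinearEquiv_apply hσ ((hd.countingSatakeLinearEquiv hσ).symm (B₀ la))
  rw [LinearEquiv.apply_symm_apply] at h1
  rw [← h1, hB₀]

end UnramifiedLocalConjDatum

end Literature.NumberTheory.Automorphic.HermitianLattice

end
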